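import Mathlib
import Literature.AlgebraicGeometry.Resolution.RegularQuotientIdeal
import HarnessLib

/-!
# [OURS · L1 W4.5(b) · EL♮(3)] HSUB(ReachTC⁺) — CODIMENSION TWO FORCES ORDER ONE: a regular quotient `R/(h, f)` of
# codimension `2` of a regular local ring has `h ∉ 𝔪²` and `f ∉ (h) + 𝔪²` (registered stub `stub_elnat_tcPlusPointResolution`;
# consumption of clause (v) of `TCPlus.Member`, brick K7c)

Crux `EquisingularLiftNat` = stmt-ResolutionOfSingularities-20038 (child EL♮(3) = stmt-ResolutionOfSingularities-20148), route
EquisingularLift, line `sections`. Helper file `--supports stmt-ResolutionOfSingularities-20148 --as helper` by res-L1-w45b-stub-1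
(HSUB(ReachTC⁺) assembly). HONEST FRAMING: OURS (cell res-hironaka, slot W4.5(b)); NOT a statement of any manuscript; AI-written,
weaker than expert review. No `sorry`; standard axioms.

WHY. Clause (v) of the invariant's `Member` (res-L1-w45b-stub-1 `…NatSubchainSupplierInvDefs` v3) records, at a closed special
point `z` of the in-carrier surface `D = V(𝓢) ∩ V(K)`, that `𝒪_{X,z} ⧸ (h, f)` is REGULAR of CODIMENSION `2` (`(h) = 𝓢_z`,
`(f) = K_z`). The order-one cone packs of F⁺5 (…NatConePackDegreeOne p529089, …NatStrictTransformComap p519966) need `h ∉ 𝔪_z²`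
and `f ∉ 𝔪_z²`, and K7a downstairs needs `(h̄, f̄)` to be part of a regular system of parameters of `𝒪_{G,y}`. This file is the
pure-algebra bridge:

* `false_of_le_span_singleton_of_codim_two` — an ideal `J ∋ g` with `J ⊆ (g)` cannot have `dim R/J + 2 = dim R` (Krull);
* **`notMem_sq_of_isRegularLocalRing_quotient_codim_two`** — `R` regular local, `h, f ∈ 𝔪`, `R ⧸ ((h) ⊔ (f))` regular with
  `dim + 2 = dim R` ⇒ `h ∉ 𝔪²` and `f ∉ (h) ⊔ 𝔪²` (Literature `exists_span_eq_of_isRegularLocalRing_quotient` selects from `{h, f}`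
  generators with independent differentials; by Krull both are selected);
* `notMem_sq_of_isRegularLocalRing_quotient_codim_two'` — the symmetric statement (`f ∉ 𝔪²`, `h ∉ (f) ⊔ 𝔪²`).

References: [cite: Matsumura1987, Thm. 14.2]; Literature/AlgebraicGeometry/Resolution/RegularQuotientIdeal.
-/

set_option linter.dupNamespace false -- mandated namespace `Summit.<Summit>.<Problem>` of this single-conjunct summit

noncomputable section

open IsLocalRing Literature.AlgebraicGeometry.Resolution

namespace Summit.ResolutionOfSingularities.ResolutionOfSingularities.Cruxes.EquisingularLiftNat.Sections

universe u

variable {R : Type u} [CommRing R]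

/-- In a Noetherian local ring, an ideal `J` contained in a principal ideal `(g)` with `g ∈ J` (so `J = (g)`) satisfies
`dim R ≤ dim R/J + 1`; hence `dim R/J + 2 = dim R` is impossible when `R ⧸ J` is a regular local ring (finite dimension).
[cite: Matsumura1987, Thm. 13.5] (Krull) -/
theorem false_of_le_span_singleton_of_codim_two [IsLocalRing R] [IsNoetherianRing R] {J : Ideal R} {g : R}
    (hg : g ∈ maximalIdeal R) (hJg : J ≤ Ideal.span {g}) (hgJ : g ∈ J) [IsRegularLocalRing (R ⧸ J)]
    (hdim : ringKrullDim (R ⧸ J) + 2 = ringKrullDim R) : False := by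
  classical
  have hJ : J = Ideal.span {g} := le_antisymm hJg ((Ideal.span_singleton_le_iff_mem _).mpr hgJ)
  have hle : ringKrullDim R ≤ ringKrullDim (R ⧸ J) + 1 := by
    have h := ringKrullDim_le_ringKrullDim_quotient_add_card (R := R) {g}
      (by rw [IsLocalRing.ringJacobson_eq_maximalIdeal, Finset.coe_singleton, Set.singleton_subset_iff]; exact hg)
    rw [Finset.coe_singleton, Finset.card_singleton, ← hJ] at h
    exact_mod_cast h
  -- `dim R/J` is a natural number (regular local rings have finite dimension)
  have hnat : ringKrullDim (R ⧸ J) = ((maximalIdeal (R ⧸ J)).spanFinrank : WithBot ℕ∞) :=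
    (IsRegularLocalRing.spanFinrank_maximalIdeal (R := R ⧸ J)).symm
  rw [hnat] at hle hdim
  rw [← hdim] at hle
  have h2 : ((maximalIdeal (R ⧸ J)).spanFinrank : WithBot ℕ∞) + 2 ≤ (maximalIdeal (R ⧸ J)).spanFinrank + 1 := hle
  have h3 : (((maximalIdeal (R ⧸ J)).spanFinrank + 2 : ℕ) : WithBot ℕ∞) ≤ (((maximalIdeal (R ⧸ J)).spanFinrank + 1 : ℕ) : WithBot ℕ∞) := by
    exact_mod_cast h2
  have h4 := (WithBot.coe_le_coe.mp h3)
  have h5 : (maximalIdeal (R ⧸ J)).spanFinrank + 2 ≤ (maximalIdeal (R ⧸ J)).spanFinrank + 1 := by exact_mod_cast h4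
  omega

/-- **Codimension two forces order one.** `R` a regular local ring, `h, f ∈ 𝔪`, `R ⧸ ((h) ⊔ (f))` regular with
`dim R ⧸ ((h) ⊔ (f)) + 2 = dim R`: then `h ∉ 𝔪²` and `f ∉ (h) ⊔ 𝔪²` (the differentials of `h` and `f` are linearly independent
in `𝔪/𝔪²`). [cite: Matsumura1987, Thm. 14.2] [OURS · L1 W4.5b] consumption of `TCPlus.Member` (v) toward
`stub_elnat_tcPlusPointResolution`; NOT a statement of the manuscript. -/
theorem notMem_sq_of_isRegularLocalRing_quotient_codim_two [IsRegularLocalRing R] {h f : R} (hh : h ∈ maximalIdeal R)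
    (hf : f ∈ maximalIdeal R) [IsRegularLocalRing (R ⧸ (Ideal.span {h} ⊔ Ideal.span {f}))]
    (hdim : ringKrullDim (R ⧸ (Ideal.span {h} ⊔ Ideal.span {f})) + 2 = ringKrullDim R) :
    h ∉ maximalIdeal R ^ 2 ∧ f ∉ Ideal.span {h} ⊔ maximalIdeal R ^ 2 := by
  classical
  set J : Ideal R := Ideal.span {h} ⊔ Ideal.span {f} with hJdef
  have hJ : J ≤ maximalIdeal R :=
    sup_le ((Ideal.span_singleton_le_iff_mem _).mpr hh) ((Ideal.span_singleton_le_iff_mem _).mpr hf)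
  have hhJ : h ∈ J := Ideal.mem_sup_left (Ideal.mem_span_singleton_self h)
  have hfJ : f ∈ J := Ideal.mem_sup_right (Ideal.mem_span_singleton_self f)
  have hJG : Ideal.span ({h, f} : Set R) = J := by rw [hJdef, Ideal.span_insert]
  obtain ⟨c, g, hgG, hspan, hli⟩ := exists_span_eq_of_isRegularLocalRing_quotient hJ {h, f} hJG
  have hgm : ∀ i, g i ∈ maximalIdeal R := fun i => hJ (hJG ▸ Ideal.subset_span (hgG i))
  -- both `h` and `f` are among the selected generators
  have hmem : ∀ {a b : R}, J = Ideal.span {a} ⊔ Ideal.span {b} → b ∈ maximalIdeal R → (∀ i, g i = a ∨ g i = b) →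
      ∃ i, g i = a := by
    intro a b hab hb hor
    by_contra hnot
    push Not at hnot
    have hall : ∀ i, g i = b := fun i => (hor i).resolve_left (hnot i)
    have hJb : J ≤ Ideal.span {b} := by
      rw [← hspan]
      refine Ideal.span_le.mpr ?_
      rintro _ ⟨i, rfl⟩
      rw [hall i]
      exact Ideal.mem_span_singleton_self b
    have hbJ : b ∈ J := by rw [hab]; exact Ideal.mem_sup_right (Ideal.mem_span_singleton_self b)
    exact false_of_le_span_singleton_of_codim_two hb hJb hbJ hdim
  have hor : ∀ i, g i = h ∨ g i = f := fun i => by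
    have := hgG i
    simp only [Set.mem_insert_iff, Set.mem_singleton_iff] at this
    exact this
  obtain ⟨i, hi⟩ := hmem rfl hf hor
  obtain ⟨i', hi'⟩ := hmem (sup_comm _ _) hh (fun l => (hor l).symm)
  -- `h ≠ f`, so `i ≠ i'`
  have hii' : i ≠ i' := by
    rintro rfl
    have hhf : h = f := hi.symm.trans hi'
    have hJh : J ≤ Ideal.span {h} := by
      rw [hJdef, hhf]; exact sup_le le_rfl le_rfl
    exact false_of_le_span_singleton_of_codim_two hh hJh hhJ hdim
  refine ⟨?_, ?_⟩
  · -- `dh ≠ 0`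
    intro hsq
    have h0 : (maximalIdeal R).toCotangent ⟨g i, hgm i⟩ = 0 := by
      rw [Ideal.toCotangent_eq_zero]
      show g i ∈ maximalIdeal R ^ 2
      rw [hi]; exact hsq
    exact hli.ne_zero i h0
  · -- `df ∉ k · dh`
    intro hmem'
    obtain ⟨a, b, hb, hab⟩ := Ideal.mem_span_singleton_sup.mp hmem'
    have hnot := hli.notMem_span_image (s := {i}) (by simpa using hii'.symm)
    apply hnot
    rw [Set.image_singleton]
    have heq : (maximalIdeal R).toCotangent ⟨g i', hgm i'⟩ =
        (IsLocalRing.residue R a) • (maximalIdeal R).toCotangent ⟨g i, hgm i⟩ := by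
      have hbm : b ∈ maximalIdeal R := Ideal.pow_le_self two_ne_zero hb
      have hahm : a * h ∈ maximalIdeal R := Ideal.mul_mem_left _ a hh
      have hsplit : (⟨g i', hgm i'⟩ : maximalIdeal R) = a • (⟨g i, hgm i⟩ : maximalIdeal R) + ⟨b, hbm⟩ := by
        apply Subtype.ext
        simp only [Submodule.coe_add, SetLike.val_smul, smul_eq_mul, hi, hi']
        exact hab.symm
      have hb0 : (maximalIdeal R).toCotangent ⟨b, hbm⟩ = 0 := (Ideal.toCotangent_eq_zero _ _).mpr hb
      rw [hsplit, map_add, hb0, add_zero, LinearMap.map_smul_of_tower]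
      exact (algebraMap_smul (ResidueField R) a _).symm
    rw [heq]
    exact Submodule.smul_mem _ _ (Submodule.subset_span rfl)

/-- The symmetric form: `f ∉ 𝔪²` and `h ∉ (f) ⊔ 𝔪²`. [cite: Matsumura1987, Thm. 14.2] -/
theorem notMem_sq_of_isRegularLocalRing_quotient_codim_two' [IsRegularLocalRing R] {h f : R} (hh : h ∈ maximalIdeal R)
    (hf : f ∈ maximalIdeal R) [hreg : IsRegularLocalRing (R ⧸ (Ideal.span {h} ⊔ Ideal.span {f}))]
    (hdim : ringKrullDim (R ⧸ (Ideal.span {h} ⊔ Ideal.span {f})) + 2 = ringKrullDim R) :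
    f ∉ maximalIdeal R ^ 2 ∧ h ∉ Ideal.span {f} ⊔ maximalIdeal R ^ 2 := by
  have he : Ideal.span {f} ⊔ Ideal.span {h} = Ideal.span {h} ⊔ Ideal.span {f} := sup_comm _ _
  haveI : IsRegularLocalRing (R ⧸ (Ideal.span {f} ⊔ Ideal.span {h})) := by rw [he]; exact hreg
  have hdim' : ringKrullDim (R ⧸ (Ideal.span {f} ⊔ Ideal.span {h})) + 2 = ringKrullDim R := by rw [he]; exact hdim
  exact notMem_sq_of_isRegularLocalRing_quotient_codim_two hf hh hdim'

end Summit.ResolutionOfSingularities.ResolutionOfSingularities.Cruxes.EquisingularLiftNat.Sections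

end
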